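import Summits.NavierStokesRegularity.NavierStokesRegularity.Theorems.StrainDoorsTypeITangentField
import Literature.Analysis.FluidPDE.ChaeWolfRemovingDSSLimit
import HarnessLib

/-! # Strain doors, PART M — second-order tangent convergence in the Type-I class (nsreg-p1 g35, ROUND-61)

In the ancient Type-I class `{classical on (−∞,0), ν = 1, f = 0, |u(t,x)| ≤ C₀/√(0−t)}`:
§M1 the KNSS regularity window at order three gives uniform bounds `‖D³u(t)‖ ≤ K₃'`, hence `∇∇u(t,·)` is
uniformly bounded and uniformly Lipschitz for `t ≤ −1/4`; §M2 ★★ along PART H's tangent extraction a further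
subsequence makes the HESSIANS converge at moving points to the Hessian of the tangent field, which is therefore
`C²` in space (`typeI_tangent_hessian`) — the transfer lemma that carries second-order peak laws (twist,
concavity: PART J/K) back to `u` itself; §M3 the scale laws of the direction field `ξ` and of its twist
`|∇ξ|²_F` under `nsRescale`, the chain rule `D(curl f) = curlCLM ∘ D(∇f)`, and continuity of `|·|²_F`.
All statements are over tree declarations; no new definitions. Helper lane of `stmt-NavierStokesRegularity-0056`
(Type-I side); nothing here bears on the Liouville crux 0057. -/

open MeasureTheory Set Function Filter Metric Real InnerProductSpace
open _root_.Topology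
open scoped ENNReal NNReal RealInnerProductSpace ContDiff Laplacian
open Literature.Analysis Literature.Analysis.FluidPDE
open Literature.Analysis.FluidPDE.VorticityDirectionDynamics

set_option maxSynthPendingDepth 3

namespace Summit.NavierStokesRegularity.NavierStokesRegularity.Theorems.StrainDoors

/-! # PART M — SECOND-ORDER TANGENT CONVERGENCE AND THE NEAR-RECORD TWIST LAWS ON `u` ITSELF

§M1 uniform third-derivative / Hessian-Lipschitz bounds in the Type-I class (KNSS window, `k = 3`);
§M2 the Hessians of a Type-I sequence converge along the tangent extraction, at moving points, to the Hessian
of the tangent field (pointwise Arzelà–Ascoli one order up + identification by quadratic Taylor bounds);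
§M3 scale laws for the direction field and its twist; §M4 the near-record extraction with twist;
§M5 the near-record TWIST PINCH and the REDUCED-STRETCHING floor/pinch on `u` itself. -/

/-! ## §M1 Third derivatives in the Type-I class -/

/-- Transfer of the KNSS window bound of order three to the classical field (copy of PART D's
`window_transfer_hess`, one order up). [folklore] -/
theorem window_transfer_D3 {T C₃ : ℝ}
    {w U : ℝ → (EuclideanSpace ℝ (Fin 3)) → (EuclideanSpace ℝ (Fin 3))} {b : ℝ → EuclideanSpace ℝ (Fin 3)}
    (hw : IsSmoothSpaceTimeOn (Ioo 0 T) w)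
    (hae : ∀ᵐ τ ∂((volume : Measure ℝ).restrict (Ioo 0 T)), w τ =ᵐ[volume] fun x => U τ x + b τ)
    (hUs : ∀ τ ∈ Ioo 0 T, ContDiff ℝ ∞ (U τ))
    (hUC : ∀ τ ∈ Ioo 1 T, ∀ x, ‖iteratedFDeriv ℝ 3 (U τ) x‖ ≤ C₃) :
    ∀ τ ∈ Ioo 1 T, ∀ x : EuclideanSpace ℝ (Fin 3), ‖iteratedFDeriv ℝ 3 (w τ) x‖ ≤ C₃ := by
  have hSU : UniqueDiffOn ℝ (Ioo 0 T) := isOpen_Ioo.uniqueDiffOn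
  have hsub1 : Ioo 1 T ⊆ Ioo 0 T := Ioo_subset_Ioo_left zero_le_one
  have hwx : ∀ τ ∈ Ioo 0 T, Continuous (w τ) := fun τ hτ => (hw.contDiff_slice hτ).continuous
  have hgood : ∀ᵐ τ ∂((volume : Measure ℝ).restrict (Ioo 0 T)),
      τ ∈ Ioo 0 T ∧ ∀ x, w τ x = U τ x + b τ := by
    filter_upwards [hae, ae_restrict_mem measurableSet_Ioo] with τ hτ hτm
    refine ⟨hτm, fun x => ?_⟩
    have hc2 : Continuous fun x => U τ x + b τ := (hUs τ hτm).continuous.add continuous_const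
    exact congr_fun ((Continuous.ae_eq_iff_eq volume (hwx τ hτm) hc2).1 hτ) x
  have hgood1 : ∀ᵐ τ ∂((volume : Measure ℝ).restrict (Ioo 1 T)),
      τ ∈ Ioo 0 T ∧ ∀ x, w τ x = U τ x + b τ :=
    ae_restrict_of_ae_restrict_of_subset hsub1 hgood
  intro τ₀ hτ₀ x
  have hcont : ContinuousOn (fun τ => ‖iteratedFDeriv ℝ 3 (w τ) x‖) (Ioo 1 T) := by
    have h1 := (((hw.fderiv_slice hSU).fderiv_slice hSU).continuousOn_fderiv_slice hSU).comp
      (continuousOn_id.prodMk continuousOn_const) (fun τ hτ => mk_mem_prod hτ (mem_univ x))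
    have h2 : ContinuousOn
        (fun τ => ‖fderiv ℝ (fun y => fderiv ℝ (fun y' => fderiv ℝ (w τ) y') y) x‖) (Ioo 1 T) :=
      (h1.mono hsub1).norm
    refine h2.congr fun τ _ => ?_
    show ‖iteratedFDeriv ℝ 3 (w τ) x‖ = ‖fderiv ℝ (fun y => fderiv ℝ (fun y' => fderiv ℝ (w τ) y') y) x‖
    rw [← norm_iteratedFDeriv_fderiv, ← norm_iteratedFDeriv_fderiv,
      ChaeWolf.norm_iteratedFDeriv_one_eq_norm_fderiv]
  refine ChaeWolf.le_of_ae_le_of_continuousOn hcont ?_ τ₀ hτ₀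
  filter_upwards [hgood1, ae_restrict_mem measurableSet_Ioo] with τ hτ hτ1
  have heq : w τ = (U τ + fun _ => b τ) := funext hτ.2
  have hU3 : ContDiffAt ℝ (3 : ℕ) (U τ) x :=
    ((hUs τ hτ.1).of_le (m := (3 : ℕ)) (by norm_cast)).contDiffAt
  have hb3 : ContDiffAt ℝ (3 : ℕ) (fun _ : EuclideanSpace ℝ (Fin 3) => b τ) x := contDiffAt_const
  rw [heq, iteratedFDeriv_add_apply hU3 hb3, iteratedFDeriv_const_of_ne (by norm_num) (b τ),
    Pi.zero_apply, add_zero]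
  exact hUC τ hτ1 x

/-- **Uniform third-derivative bound in the Type-I class** (KNSS 2009 §4, `k = 3`, on the window
`(t − 2, t + 1/8)`): `‖D³u(t,x)‖ ≤ K₃'` for all `t ≤ −1/4`. [cite: KochNadirashviliSereginSverak2009, §4 (4.11)] -/
theorem exists_uniform_D3Bound {C₀ : ℝ} (hC₀ : 0 ≤ C₀) :
    ∃ K₃ : ℝ, 0 ≤ K₃ ∧ ∀ {u : ℝ → EuclideanSpace ℝ (Fin 3) → EuclideanSpace ℝ (Fin 3)}
      {p : ℝ → EuclideanSpace ℝ (Fin 3) → ℝ},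
      IsClassicalNSSolutionOn (Iio 0) 1 0 u p → HasTypeIDecay C₀ u →
        ∀ t ≤ -(1 / 4 : ℝ), ∀ x, ‖iteratedFDeriv ℝ 3 (u t) x‖ ≤ K₃ := by
  obtain ⟨Cw, Lw, N, hwin⟩ :=
    KNSS2009_regularity_boundedWeak_window_holds (3 * C₀) (17 / 8) (by norm_num)
  refine ⟨max (Cw 3 1) 0, le_max_right _ _, ?_⟩
  intro u p hcl hI t ht x
  set a : ℝ := t - 2 with ha
  set w : ℝ → EuclideanSpace ℝ (Fin 3) → EuclideanSpace ℝ (Fin 3) := fun τ => u (τ + a) with hw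
  have hIoo : Ioo a (a + 17 / 8) ⊆ Iio 0 := fun τ hτ => by
    simp only [mem_Iio]; linarith [hτ.2]
  have hneg : ∀ τ ∈ Ioo (0 : ℝ) (17 / 8), τ + a < -(1 / 8 : ℝ) := fun τ hτ => by
    linarith [hτ.2]
  have hcl' : IsClassicalNSSolutionOn (Ioo a (a + 17 / 8)) 1 0 u p :=
    hcl.mono hIoo (uniqueDiffOn_Ioo _ _)
  have hbdd : IsBoundedOn (Ioo a (a + 17 / 8)) u :=
    ⟨3 * C₀, fun τ hτ x => ChaeWolf.typeI_norm_le_three_mul hC₀ hI (by linarith [hτ.2]) x⟩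
  have hweak : IsBoundedWeakNSSolutionOn (Ioo 0 (17 / 8)) isOpen_Ioo 1 w :=
    (hcl'.isBoundedWeakNSSolutionOn hbdd).comp_add_right a (J := Ioo 0 (17 / 8)) isOpen_Ioo
      fun τ => by
        simp only [mem_Ioo]
        constructor <;> intro h <;> constructor <;> linarith [h.1, h.2]
  have hM : ∀ τ ∈ Ioo (0 : ℝ) (17 / 8), ∀ x, ‖w τ x‖ ≤ 3 * C₀ := fun τ hτ x =>
    ChaeWolf.typeI_norm_le_three_mul hC₀ hI (hneg τ hτ) x
  obtain ⟨U, b, -, -, -, hae, hUs, -, hUC, -, -⟩ := hwin hweak hM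
  have hws : IsSmoothSpaceTimeOn (Ioo 0 (17 / 8)) w := by
    have h1 := hcl.smooth_velocity.comp_add_right a
    refine h1.mono fun τ hτ => ?_
    simp only [mem_preimage, mem_Iio]
    linarith [hneg τ hτ]
  have key := window_transfer_D3 hws hae hUs (hUC 1 one_pos 3)
  have h2 : (2 : ℝ) ∈ Ioo (1 : ℝ) (17 / 8) := ⟨by norm_num, by norm_num⟩
  have e2 : w 2 = u t := by simp only [hw, ha]; congr 1; ring
  have := key 2 h2 x
  rw [e2] at this
  exact this.trans (le_max_left _ _)

/-- **Uniform Hessian bound and Hessian Lipschitz bound in the Type-I class**, in `∇∇` form: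
`‖D²u(t,x)‖ ≤ K₂` and `‖D²u(t,x) − D²u(t,y)‖ ≤ K₃'|x − y|` for `t ≤ −1/4` (mean value inequality with §M1). [folklore] -/
theorem exists_uniform_hessLipschitz {C₀ : ℝ} (hC₀ : 0 ≤ C₀) :
    ∃ K₂ K₃ : ℝ, 0 ≤ K₂ ∧ 0 ≤ K₃ ∧ ∀ {u : ℝ → EuclideanSpace ℝ (Fin 3) → EuclideanSpace ℝ (Fin 3)}
      {p : ℝ → EuclideanSpace ℝ (Fin 3) → ℝ},
      IsClassicalNSSolutionOn (Iio 0) 1 0 u p → HasTypeIDecay C₀ u →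
        (∀ t ≤ -(1 / 4 : ℝ), ∀ x, ‖fderiv ℝ (fderiv ℝ (u t)) x‖ ≤ K₂) ∧
        (∀ t ≤ -(1 / 4 : ℝ), ∀ x y,
          ‖fderiv ℝ (fderiv ℝ (u t)) x - fderiv ℝ (fderiv ℝ (u t)) y‖ ≤ K₃ * ‖x - y‖) := by
  obtain ⟨K₂, hK₂, hhess⟩ := exists_uniform_hessBound hC₀
  obtain ⟨K₃, hK₃, hD3⟩ := exists_uniform_D3Bound hC₀
  refine ⟨K₂, K₃, hK₂, hK₃, @fun u p hcl hI => ⟨fun t ht x => ?_, fun t ht x y => ?_⟩⟩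
  · rw [← norm_iteratedFDeriv_zero (𝕜 := ℝ) (f := fderiv ℝ (fderiv ℝ (u t))),
      norm_iteratedFDeriv_fderiv, norm_iteratedFDeriv_fderiv]
    exact hhess hcl hI t ht x
  · have ht0 : t ∈ Iio (0 : ℝ) := by simp only [mem_Iio]; linarith
    have hd : Differentiable ℝ (fderiv ℝ (fderiv ℝ (u t))) :=
      (((hcl.contDiff_velocity ht0).fderiv_right (m := 2) (by norm_cast)).fderiv_right (m := 1)
        (by norm_cast)).differentiable (by norm_cast)
    have hdiff : ∀ z ∈ (univ : Set (EuclideanSpace ℝ (Fin 3))),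
        DifferentiableAt ℝ (fderiv ℝ (fderiv ℝ (u t))) z := fun z _ => hd z
    have hbound : ∀ z ∈ (univ : Set (EuclideanSpace ℝ (Fin 3))),
        ‖fderiv ℝ (fderiv ℝ (fderiv ℝ (u t))) z‖ ≤ K₃ := by
      intro z _
      rw [← norm_iteratedFDeriv_zero (𝕜 := ℝ) (f := fderiv ℝ (fderiv ℝ (fderiv ℝ (u t)))),
        norm_iteratedFDeriv_fderiv, norm_iteratedFDeriv_fderiv, norm_iteratedFDeriv_fderiv]
      exact hD3 hcl hI t ht z
    exact Convex.norm_image_sub_le_of_norm_fderiv_le hdiff hbound convex_univ (mem_univ y)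
      (mem_univ x)

/-! ## §M2 Second-order tangent convergence -/

/-- ★★ **THE HESSIANS CONVERGE ALONG THE TANGENT EXTRACTION.**  Let `u_n` be classical Type-I solutions (one
`C₀`) whose gradients at a time `t ≤ −1/4` converge pointwise to the gradient of a field `v(t,·)` (the output of
PART H's `typeI_tangent_field`).  Then along a further subsequence `ψ` the Hessians converge AT MOVING POINTS,
`D²u_{ψ(n)}(t, x_n) → D²v(t, x₀)` whenever `x_n → x₀`, and `∇v(t,·)` is differentiable with derivative `D²v(t,·)`
(pointwise Arzelà–Ascoli on the equi-Lipschitz, equi-bounded Hessians (§M1) + identification of the limit by the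
uniform quadratic Taylor bounds of PART H). [new-as-typed; folklore mechanism] -/
theorem typeI_tangent_hessian {C₀ : ℝ} (hC₀ : 0 ≤ C₀)
    {u : ℕ → ℝ → (EuclideanSpace ℝ (Fin 3)) → (EuclideanSpace ℝ (Fin 3))}
    {p : ℕ → ℝ → (EuclideanSpace ℝ (Fin 3)) → ℝ}
    (hcl : ∀ n, IsClassicalNSSolutionOn (Iio 0) 1 0 (u n) (p n)) (hI : ∀ n, HasTypeIDecay C₀ (u n))
    {v : ℝ → (EuclideanSpace ℝ (Fin 3)) → (EuclideanSpace ℝ (Fin 3))} {t : ℝ} (ht : t ≤ -(1 / 4 : ℝ))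
    (hlimD : ∀ x, Tendsto (fun n => fderiv ℝ (u n t) x) atTop (𝓝 (fderiv ℝ (v t) x))) :
    ∃ ψ : ℕ → ℕ, StrictMono ψ ∧
      (∀ x, HasFDerivAt (fderiv ℝ (v t)) (fderiv ℝ (fderiv ℝ (v t)) x) x) ∧
      ∀ (x : ℕ → EuclideanSpace ℝ (Fin 3)) (x₀ : EuclideanSpace ℝ (Fin 3)), Tendsto x atTop (𝓝 x₀) →
        Tendsto (fun n => fderiv ℝ (fderiv ℝ (u (ψ n) t)) (x n)) atTop
          (𝓝 (fderiv ℝ (fderiv ℝ (v t)) x₀)) := by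
  obtain ⟨K₂, K₃, hK₂, hK₃, hH⟩ := exists_uniform_hessLipschitz hC₀
  have ht0 : t ∈ Iio (0 : ℝ) := by simp only [mem_Iio]; linarith
  set g : ℕ → (EuclideanSpace ℝ (Fin 3)) →
      ((EuclideanSpace ℝ (Fin 3)) →L[ℝ] ((EuclideanSpace ℝ (Fin 3)) →L[ℝ] (EuclideanSpace ℝ (Fin 3)))) :=
    fun n y => fderiv ℝ (fderiv ℝ (u n t)) y with hg
  have hlip : ∀ n, LipschitzWith (Real.toNNReal K₃) (g n) := fun n =>
    LipschitzWith.of_dist_le_mul fun a b => by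
      rw [dist_eq_norm, dist_eq_norm, Real.coe_toNNReal K₃ hK₃]
      exact (hH (hcl n) (hI n)).2 t ht a b
  have hball : ∀ n y, g n y ∈ closedBall
      (0 : (EuclideanSpace ℝ (Fin 3)) →L[ℝ] ((EuclideanSpace ℝ (Fin 3)) →L[ℝ] (EuclideanSpace ℝ (Fin 3))))
      K₂ := fun n y => by
    rw [mem_closedBall, dist_zero_right]
    exact (hH (hcl n) (hI n)).1 t ht y
  obtain ⟨ψ, G, hψ, -, -, hconv⟩ := exists_strictMono_tendsto_of_lipschitzWith g hlip hball
  -- identification of the limit: `G = D²v(t)`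
  have hGeq : ∀ x, HasFDerivAt (fderiv ℝ (v t)) (G x) x := by
    intro x
    refine hasFDerivAt_of_tendsto_of_quadratic (K := K₃) (f := fun n => fderiv ℝ (u (ψ n) t))
      (A := fun n => g (ψ n) x) (fun n h => ?_) (fun y => (hlimD y).comp hψ.tendsto_atTop) (hconv x)
    have hd : Differentiable ℝ (fderiv ℝ (u (ψ n) t)) :=
      (((hcl (ψ n)).contDiff_velocity ht0).fderiv_right (m := 1) (by norm_cast)).differentiable
        (by norm_cast)
    exact taylor_quadratic_of_fderiv_lipschitz hd hK₃ ((hH (hcl (ψ n)) (hI (ψ n))).2 t ht) x h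
  refine ⟨ψ, hψ, fun x => ?_, fun x x₀ hx => ?_⟩
  · rw [(hGeq x).fderiv]; exact hGeq x
  · rw [(hGeq x₀).fderiv]
    exact ChaeWolf.tendsto_apply_of_tendsto (fun n => hlip (ψ n)) hx (hconv x₀)

/-! ## §M3 Scale laws for the direction field and the twist -/

/-- `|cL|²_F = c²|L|²_F`. [folklore] -/
theorem frobeniusNormSq_smul_left (c : ℝ)
    (L : (EuclideanSpace ℝ (Fin 3)) →L[ℝ] (EuclideanSpace ℝ (Fin 3))) :
    frobeniusNormSq (c • L) = c ^ 2 * frobeniusNormSq L := by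
  unfold frobeniusNormSq
  rw [Finset.mul_sum]
  refine Finset.sum_congr rfl fun i _ => ?_
  rw [show (c • L) (stdOrthonormalBasis ℝ (EuclideanSpace ℝ (Fin 3)) i) =
    c • L (stdOrthonormalBasis ℝ (EuclideanSpace ℝ (Fin 3)) i) from rfl, norm_smul, mul_pow,
    Real.norm_eq_abs, sq_abs]

/-- **The direction field is scale invariant**: `ξ_{u_λ}(s, y) = ξ_u(λ²s, λy)` (`curl u_λ = λ² (curl u)(λ²s, λ·)`
and `ξ` ignores positive multiples). [folklore] -/
theorem vorticityDirection_curl_nsRescale {c : ℝ} (hc : 0 < c)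
    (u : ℝ → (EuclideanSpace ℝ (Fin 3)) → (EuclideanSpace ℝ (Fin 3))) (s : ℝ) (y : EuclideanSpace ℝ (Fin 3)) :
    vorticityDirection (curl (nsRescale c u s)) y = vorticityDirection (curl (u (c ^ 2 * s))) (c • y) := by
  have hc2 : c ^ 2 ≠ 0 := pow_ne_zero 2 hc.ne'
  rw [vorticityDirection_apply, vorticityDirection_apply, curl_eq_curlCLM, curl_eq_curlCLM, fderiv_nsRescale,
    map_smul, norm_smul, Real.norm_of_nonneg (sq_nonneg c), mul_inv, smul_smul, mul_right_comm,
    inv_mul_cancel₀ hc2, one_mul]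

/-- **The twist is scale covariant**: `|∇ξ_{u_λ}|²_F(s, y) = λ²·|∇ξ_u|²_F(λ²s, λy)` wherever `ξ_u(λ²s,·)` is
differentiable at `λy`; hence `(0 − s)|∇ξ|²_F` is scale free. [folklore] -/
theorem twist_nsRescale {c : ℝ} (hc : 0 < c)
    (u : ℝ → (EuclideanSpace ℝ (Fin 3)) → (EuclideanSpace ℝ (Fin 3))) (s : ℝ) (y : EuclideanSpace ℝ (Fin 3))
    (hd : DifferentiableAt ℝ (vorticityDirection (curl (u (c ^ 2 * s)))) (c • y)) :
    frobeniusNormSq (fderiv ℝ (vorticityDirection (curl (nsRescale c u s))) y) =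
      c ^ 2 * frobeniusNormSq (fderiv ℝ (vorticityDirection (curl (u (c ^ 2 * s)))) (c • y)) := by
  have hfun : vorticityDirection (curl (nsRescale c u s)) =
      fun y => vorticityDirection (curl (u (c ^ 2 * s))) (c • y) :=
    funext fun y => vorticityDirection_curl_nsRescale hc u s y
  have hlin : HasFDerivAt (fun y : EuclideanSpace ℝ (Fin 3) => c • y)
      (c • ContinuousLinearMap.id ℝ (EuclideanSpace ℝ (Fin 3))) y :=
    (hasFDerivAt_id y).const_smul c
  have hcomp : HasFDerivAt (fun y => vorticityDirection (curl (u (c ^ 2 * s))) (c • y))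
      ((fderiv ℝ (vorticityDirection (curl (u (c ^ 2 * s)))) (c • y)).comp
        (c • ContinuousLinearMap.id ℝ (EuclideanSpace ℝ (Fin 3)))) y :=
    hd.hasFDerivAt.comp y hlin
  have hcs : (fderiv ℝ (vorticityDirection (curl (u (c ^ 2 * s)))) (c • y)).comp
      (c • ContinuousLinearMap.id ℝ (EuclideanSpace ℝ (Fin 3))) =
      c • fderiv ℝ (vorticityDirection (curl (u (c ^ 2 * s)))) (c • y) := by
    ext z
    simp
  rw [hfun, hcomp.fderiv, hcs, frobeniusNormSq_smul_left]

/-- `curl f` is differentiated through `curl = curlCLM ∘ ∇`: a Fréchet derivative `H` of `∇f` at `x` gives the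
Fréchet derivative `curlCLM ∘ H` of `curl f` at `x`. [folklore] -/
theorem hasFDerivAt_curl_of_hasFDerivAt_fderiv {f : (EuclideanSpace ℝ (Fin 3)) → (EuclideanSpace ℝ (Fin 3))}
    {H : (EuclideanSpace ℝ (Fin 3)) →L[ℝ] ((EuclideanSpace ℝ (Fin 3)) →L[ℝ] (EuclideanSpace ℝ (Fin 3)))}
    {x : EuclideanSpace ℝ (Fin 3)} (h : HasFDerivAt (fderiv ℝ f) H x) :
    HasFDerivAt (curl f) (curlCLM.comp H) x := by
  have hc : HasFDerivAt (⇑(curlCLM : ((EuclideanSpace ℝ (Fin 3)) →L[ℝ] (EuclideanSpace ℝ (Fin 3))) →L[ℝ]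
      (EuclideanSpace ℝ (Fin 3)))) curlCLM (fderiv ℝ f x) := ContinuousLinearMap.hasFDerivAt curlCLM
  have h2 := HasFDerivAt.comp x hc h
  exact h2

/-- Continuity of the Frobenius norm along a convergent sequence of linear maps. [folklore] -/
theorem tendsto_frobeniusNormSq {L : ℕ → (EuclideanSpace ℝ (Fin 3)) →L[ℝ] (EuclideanSpace ℝ (Fin 3))}
    {Lbar : (EuclideanSpace ℝ (Fin 3)) →L[ℝ] (EuclideanSpace ℝ (Fin 3))} (hL : Tendsto L atTop (𝓝 Lbar)) :
    Tendsto (fun j => frobeniusNormSq (L j)) atTop (𝓝 (frobeniusNormSq Lbar)) := by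
  have happly : Continuous fun w : ((EuclideanSpace ℝ (Fin 3)) →L[ℝ] (EuclideanSpace ℝ (Fin 3))) ×
      (EuclideanSpace ℝ (Fin 3)) => w.1 w.2 := isBoundedBilinearMap_apply.continuous
  unfold frobeniusNormSq
  refine tendsto_finsetSum _ fun i _ => ?_
  exact (((happly.tendsto (Lbar, stdOrthonormalBasis ℝ (EuclideanSpace ℝ (Fin 3)) i)).comp
    (hL.prodMk_nhds tendsto_const_nhds)).norm).pow 2

end Summit.NavierStokesRegularity.NavierStokesRegularity.Theorems.StrainDoors
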